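import Summits.HubbardSuperconductivity.HubbardSuperconductivity.Theorems.BalabanIRBirGappedPhaseReductionTorusZeroModeCoercivity
import HarnessLib

/-!
# Route BalabanIR — crux 4 `BirGappedPhaseReduction` / 4R (items `stmt-HubbardSuperconductivity-2082`, `…-14846`):
# closed forms — the aligned history (Trotterised BdG partition function) and the explicit ratio

Companion of `…TorusZeroModeCoercivity` (the Fock-level zero-mode temporal coercivity). Two closed
forms make the bound READABLE as a ratio to the aligned history:

* `gibbsWeight_pow` — `(e^{-aH})^m = e^{-(ma)H}`; `trace_gibbsWeight_symbolBlock` — `tr e^{-ah} = 2cosh(aE)`,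
  `E = √(ξ² + ‖D‖²)` for the symbol block `h = !![ξ, D; conj D, -ξ]` (degenerate block included);
  `det_one_add_gibbsWeight_symbolBlock_pow` — `det(1 + (e^{-ah})^{m+1}) = 2 + 2cosh((m+1)aE)`;
* **`trace_prod_gibbsWeight_bdgTorus_const_phase`** — the ALIGNED history (constant global pair phase)
  over `m + 1` slices in closed form:
  `Tr ∏_t e^{-aH_BdG(η, e^{ic}Δ, μ)} = e^{-a(m+1)|Λ|(η 0 - μ)} · ∏_k (2 + 2cosh((m+1)·a·E_k))`,
  `E_k = √((Re η̂′ k)² + ‖Δ̂ k‖²)` — the Bogoliubov–de Gennes partition function of the torus reference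
  (empty + broken pair, and the pair doublet `e^{±(m+1)aE_k}`, per mode);
* `diagonal_conj_pow`, `trace_pow_gaugeFix_eq` (`tr Ĝ^j = tr G^j` for the gauge-fixed real form of a
  Hermitian `2 × 2` matrix), `trace_gaugeFix_gibbsWeight_symbolBlock_pow` (`tr Ĝ_k^j = 2cosh(jaE_k)`);
* **`exists_coercive_norm_trace_prod_gibbsWeight_bdgTorus_phase_le_cosh`** — for `a ≠ 0` ONE family
  `κ_k ≥ 0`, `κ_k > 0` at every mode with `Δ̂ k ≠ 0`, such that for every even number `2n+2` of slices
  and every closed history of global pair phases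
  `‖Tr ∏_t e^{-aH_BdG(η, e^{iθ_t}Δ, μ)}‖ ≤ |e^{-a(2n+2)|Λ|(η 0 - μ)}| · ∏_k (2 + 2cosh((2n+2)aE_k)·e^{-(κ_k/2) Σ_t (1 - cos(θ_{t+1} - θ_t))})`.

Set against the aligned value `∏_k (2 + 2cosh((2n+2)aE_k))`: every mode's pair doublet is damped by
`e^{-(κ_k/2)S(θ)}`, `S(θ) = Σ_t (1 - cos(θ_{t+1} - θ_t))`, and `2/(2 + 2cosh((2n+2)aE_k)) → 0` with the
number of slices, so relative to the aligned history a zero-mode phase history weighs eventually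
`≲ e^{-(Σ_k κ_k/2)·S(θ)}` — an EXTENSIVE (`∝ |Λ|` off the gap nodes) temporal phase stiffness of the
fermion-induced weight: the temporal half of hypothesis (C) of crux 2R for the route's reference, zero
spatial mode, uniformly in the number of slices, in closed form.

`Theses`-free, no definitions; `--supports` the crux. [folklore]
-/

noncomputable section

namespace Summit.HubbardSuperconductivity.HubbardSuperconductivity.Theorems

namespace BirBdG

open Matrix NormedSpace Literature.Probability.LatticeModels Literature.MathematicalPhysics.QuantumLattice
open scoped ComplexConjugate ComplexOrder

/-! ### Closed forms per mode and the aligned history -/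

section Aligned

/-- Powers of a Gibbs weight: `(e^{-aH})^m = e^{-(ma)H}`. [folklore] -/
theorem gibbsWeight_pow {p : Type*} [Fintype p] [DecidableEq p] (a : ℝ) (H : Matrix p p ℂ) :
    ∀ m : ℕ, Matrix.gibbsWeight a H ^ m = Matrix.gibbsWeight (m * a) H
  | 0 => by simp
  | m + 1 => by
      rw [pow_succ, gibbsWeight_pow a H m, Matrix.gibbsWeight, Matrix.gibbsWeight, Matrix.gibbsWeight,
        ← Matrix.exp_add_of_commute _ _ (((Commute.refl H).smul_left _).smul_right _), ← add_smul]
      congr 2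
      push_cast
      ring1

/-- The trace of a symbol-block Gibbs weight: `tr e^{-a h} = 2 cosh(aE)`, `E = √(ξ² + ‖D‖²)`
(also in the degenerate case). [folklore] -/
theorem trace_gibbsWeight_symbolBlock (ξ : ℝ) (D : ℂ) (a : ℝ) :
    (Matrix.gibbsWeight a (!![(ξ : ℂ), D; star D, -(ξ : ℂ)] : Matrix (Fin 2) (Fin 2) ℂ)).trace =
      ((2 * Real.cosh (a * Real.sqrt (ξ ^ 2 + ‖D‖ ^ 2)) : ℝ) : ℂ) := by
  by_cases hE : ξ ^ 2 + ‖D‖ ^ 2 = 0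
  · have hξ : ξ = 0 := by nlinarith [sq_nonneg ξ, sq_nonneg ‖D‖]
    have hD : D = 0 := norm_eq_zero.mp (by nlinarith [sq_nonneg ξ, sq_nonneg ‖D‖, norm_nonneg D])
    subst hξ hD
    have h0 : (!![((0 : ℝ) : ℂ), 0; star 0, -((0 : ℝ) : ℂ)] : Matrix (Fin 2) (Fin 2) ℂ) = 0 := by
      ext i j
      fin_cases i <;> fin_cases j <;> simp
    rw [h0, Matrix.gibbsWeight, smul_zero, NormedSpace.exp_zero, trace_one, Fintype.card_fin]
    simp
  · rw [gibbsWeight_symbolBlock ξ D a hE, trace_sub, trace_smul, trace_smul, trace_one, Fintype.card_fin,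
      trace_fin_two_of]
    push_cast
    ring1

/-- Per mode, the aligned Trotter determinant in closed form:
`det(1 + (e^{-ah})^{m+1}) = 2 + 2cosh((m+1)aE)` (`det e^{-ah} = 1`, `tr e^{-(m+1)ah} = 2cosh((m+1)aE)`).
[folklore] -/
theorem det_one_add_gibbsWeight_symbolBlock_pow (ξ : ℝ) (D : ℂ) (a : ℝ) (m : ℕ) :
    (1 + Matrix.gibbsWeight a (!![(ξ : ℂ), D; star D, -(ξ : ℂ)] : Matrix (Fin 2) (Fin 2) ℂ) ^ (m + 1)).det =
      ((2 + 2 * Real.cosh ((m + 1) * a * Real.sqrt (ξ ^ 2 + ‖D‖ ^ 2)) : ℝ) : ℂ) := by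
  rw [det_one_add_fin_two, det_pow, det_gibbsWeight_symbolBlock_eq_one, one_pow, gibbsWeight_pow,
    trace_gibbsWeight_symbolBlock]
  push_cast
  ring1

variable {Λ : Type*} [LinearOrder Λ] [Fintype Λ] {L : ℕ} [NeZero L]

/-- **The aligned history in closed form (the Trotterised BdG partition function of the torus
reference).** For a CONSTANT global pair phase `θ_t ≡ c` over `m + 1` slices,
`Tr ∏_t e^{-aH_BdG(η, e^{ic}Δ, μ)} = e^{-a(m+1)|Λ|(η 0 - μ)} · ∏_k (2 + 2cosh((m+1)·a·E_k))`,
`E_k = √((Re η̂′ k)² + ‖Δ̂ k‖²)` — empty + broken pair (`2`) and the bonding/antibonding pair doublet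
(`e^{±(m+1)aE_k}`) of each mode (Bardeen–Cooper–Schrieffer; Bogoliubov–de Gennes). [folklore] -/
theorem trace_prod_gibbsWeight_bdgTorus_const_phase (e : Λ ≃ TorusSite 2 L)
    (η Δv : TorusSite 2 L → ℂ) (hη : ∀ r, η (-r) = η r) (hΔ : ∀ r, Δv (-r) = Δv r) (μ a : ℝ)
    (hreal : ∀ k, star (torusFourier (fun r => η r - if r = 0 then (μ : ℂ) else 0) k) =
      torusFourier (fun r => η r - if r = 0 then (μ : ℂ) else 0) k)
    {m : ℕ} (c : ℝ) :
    ((List.ofFn fun _ : Fin (m + 1) => Matrix.gibbsWeight a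
        (bdgBondHamiltonian (fun u v => η (e u - e v))
          (fun u v => Complex.exp (Complex.I * c) * (-(1 / 2 : ℂ) * star (Δv (e u - e v)))) μ)).prod).trace =
      Complex.exp (-(a : ℂ) * ∑ _t : Fin (m + 1), ∑ _x : Λ, (η 0 - μ)) *
        ∏ k : TorusSite 2 L, (((2 + 2 * Real.cosh ((m + 1) * a *
          Real.sqrt ((torusFourier (fun r => η r - if r = 0 then (μ : ℂ) else 0) k).re ^ 2 +
            ‖torusFourier Δv k‖ ^ 2))) : ℝ) : ℂ) := by
  rw [trace_prod_gibbsWeight_bdgTorus_phase_eq_prod_modes e η Δv hη hΔ μ a (fun _ : Fin (m + 1) => c)]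
  congr 1
  refine Finset.prod_congr rfl fun k _ => ?_
  have hξ : (((torusFourier (fun r => η r - if r = 0 then (μ : ℂ) else 0) k).re : ℝ) : ℂ) =
      torusFourier (fun r => η r - if r = 0 then (μ : ℂ) else 0) k := Complex.conj_eq_iff_re.mp (hreal k)
  have hdiag : (diagonal ![Complex.exp (((-((c - c) / 2) : ℝ) : ℂ) * Complex.I),
      Complex.exp ((((c - c) / 2 : ℝ) : ℂ) * Complex.I)] : Matrix (Fin 2) (Fin 2) ℂ) = 1 := by
    rw [sub_self, zero_div, neg_zero, Complex.ofReal_zero, zero_mul, Complex.exp_zero, ← diagonal_one]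
    congr 1
    funext i
    fin_cases i <;> rfl
  rw [hdiag]
  simp only [Matrix.mul_one, List.ofFn_const, List.prod_replicate]
  have h := det_one_add_gibbsWeight_symbolBlock_pow
    (torusFourier (fun r => η r - if r = 0 then (μ : ℂ) else 0) k).re (torusFourier Δv k) a m
  rw [hξ] at h
  exact h

end Aligned

/-! ### The explicit ratio -/

section Ratio

/-- Conjugating by `v = diag(1, w)`, `|w| = 1`, commutes with powers. [folklore] -/
theorem diagonal_conj_pow (w : ℂ) (hw : star w * w = 1) (A : Matrix (Fin 2) (Fin 2) ℂ) :
    ∀ j : ℕ, (diagonal ![(1 : ℂ), w] * A * (diagonal ![(1 : ℂ), w])ᴴ) ^ j =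
      diagonal ![(1 : ℂ), w] * A ^ j * (diagonal ![(1 : ℂ), w])ᴴ
  | 0 => by
      have hvv : diagonal ![(1 : ℂ), w] * (diagonal ![(1 : ℂ), w])ᴴ = 1 := by
        rw [diagonal_conjTranspose, diagonal_mul_diagonal, ← diagonal_one]
        congr 1
        funext i
        fin_cases i
        · simp
        · simp only [Fin.mk_one, Matrix.cons_val_one, Matrix.cons_val_fin_one, Pi.star_apply]
          rw [mul_comm]; exact hw
      rw [pow_zero, pow_zero, Matrix.mul_one, hvv]
  | j + 1 => by
      have hvv' : (diagonal ![(1 : ℂ), w])ᴴ * diagonal ![(1 : ℂ), w] = 1 := by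
        rw [diagonal_conjTranspose, diagonal_mul_diagonal, ← diagonal_one]
        congr 1
        funext i
        fin_cases i
        · simp
        · simpa using hw
      rw [pow_succ, diagonal_conj_pow w hw A j, pow_succ]
      simp only [Matrix.mul_assoc]
      rw [← Matrix.mul_assoc ((diagonal ![(1 : ℂ), w])ᴴ) (diagonal ![(1 : ℂ), w]), hvv', Matrix.one_mul]

/-- **The gauge-fixed real form has the same power traces**: for Hermitian `G`,
`tr Ĝ^j = tr G^j`, `Ĝ = !![Re G₀₀, ‖G₁₀‖; ‖G₁₀‖, Re G₁₁]`. [folklore] -/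
theorem trace_pow_gaugeFix_eq {G : Matrix (Fin 2) (Fin 2) ℂ} (hG : G.IsHermitian) (j : ℕ) :
    ((((!![(G 0 0).re, ‖G 1 0‖; ‖G 1 0‖, (G 1 1).re] : Matrix (Fin 2) (Fin 2) ℝ) ^ j).trace : ℝ) : ℂ) =
      (G ^ j).trace := by
  obtain ⟨w, hw, hGeq⟩ := twoState_gauge hG
  have hvv' : (diagonal ![(1 : ℂ), w])ᴴ * diagonal ![(1 : ℂ), w] = 1 := by
    rw [diagonal_conjTranspose, diagonal_mul_diagonal, ← diagonal_one]
    congr 1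
    funext i
    fin_cases i
    · simp
    · simpa using hw
  conv_rhs => rw [hGeq, diagonal_conj_pow w hw _ j, trace_mul_cycle, hvv', Matrix.one_mul]
  have hmap : ((!![(G 0 0).re, ‖G 1 0‖; ‖G 1 0‖, (G 1 1).re] : Matrix (Fin 2) (Fin 2) ℝ).map
      ((↑) : ℝ → ℂ)) ^ j =
      (((!![(G 0 0).re, ‖G 1 0‖; ‖G 1 0‖, (G 1 1).re] : Matrix (Fin 2) (Fin 2) ℝ)) ^ j).map ((↑) : ℝ → ℂ) := by
    have h := (map_pow Complex.ofRealHom.mapMatrix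
      ((!![(G 0 0).re, ‖G 1 0‖; ‖G 1 0‖, (G 1 1).re] : Matrix (Fin 2) (Fin 2) ℝ)) j).symm
    rw [RingHom.mapMatrix_apply, RingHom.mapMatrix_apply] at h
    exact h
  rw [hmap]
  exact AddMonoidHom.map_trace Complex.ofRealHom.toAddMonoidHom _

/-- Per mode, the power traces of the gauge-fixed Gibbs weight in closed form:
`tr Ĝ^j = tr e^{-jah} = 2cosh(jaE)`. [folklore] -/
theorem trace_gaugeFix_gibbsWeight_symbolBlock_pow (ξ : ℝ) (D : ℂ) (a : ℝ) (j : ℕ) :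
    ((!![(Matrix.gibbsWeight a (!![(ξ : ℂ), D; star D, -(ξ : ℂ)] : Matrix (Fin 2) (Fin 2) ℂ) 0 0).re,
          ‖Matrix.gibbsWeight a (!![(ξ : ℂ), D; star D, -(ξ : ℂ)] : Matrix (Fin 2) (Fin 2) ℂ) 1 0‖;
        ‖Matrix.gibbsWeight a (!![(ξ : ℂ), D; star D, -(ξ : ℂ)] : Matrix (Fin 2) (Fin 2) ℂ) 1 0‖,
          (Matrix.gibbsWeight a (!![(ξ : ℂ), D; star D, -(ξ : ℂ)] : Matrix (Fin 2) (Fin 2) ℂ) 1 1).re] :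
        Matrix (Fin 2) (Fin 2) ℝ) ^ j).trace = 2 * Real.cosh (j * a * Real.sqrt (ξ ^ 2 + ‖D‖ ^ 2)) := by
  have hh : (!![(ξ : ℂ), D; star D, -(ξ : ℂ)] : Matrix (Fin 2) (Fin 2) ℂ).IsHermitian :=
    isHermitian_symbolBlock (Complex.conj_ofReal ξ)
  have h := trace_pow_gaugeFix_eq (isHermitian_gibbsWeight a hh) j
  rw [gibbsWeight_pow, trace_gibbsWeight_symbolBlock] at h
  exact_mod_cast h

variable {Λ : Type*} [LinearOrder Λ] [Fintype Λ] {L : ℕ} [NeZero L]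

/-- **Zero-mode temporal coercivity in closed form.** In the setting of
`exists_coercive_norm_trace_prod_gibbsWeight_bdgTorus_phase_le` (`a ≠ 0`): ONE family `κ_k ≥ 0`,
`κ_k > 0` at every mode with `Δ̂ k ≠ 0`, such that for every even number `2n+2` of slices and every
closed history of global pair phases
`‖Tr ∏_t e^{-aH_BdG(η, e^{iθ_t}Δ, μ)}‖ ≤ |e^{-a(2n+2)|Λ|(η 0 - μ)}| · ∏_k (2 + 2cosh((2n+2)·a·E_k) · e^{-(κ_k/2) Σ_t (1 - cos(θ_{t+1} - θ_t))})`;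
compare the ALIGNED history `trace_prod_gibbsWeight_bdgTorus_const_phase`:
`= e^{-a(2n+2)|Λ|(η 0 - μ)} · ∏_k (2 + 2cosh((2n+2)·a·E_k))` — each mode's pair doublet is damped by
`e^{-(κ_k/2)S(θ)}`, and since `2 / (2 + 2cosh((2n+2)aE_k)) → 0` as the number of slices grows, the
weight of a zero-mode phase history relative to the aligned one is eventually `≲ e^{-(Σ_k κ_k/2)·S(θ)}`:
an EXTENSIVE temporal phase stiffness. [folklore] -/
theorem exists_coercive_norm_trace_prod_gibbsWeight_bdgTorus_phase_le_cosh (e : Λ ≃ TorusSite 2 L)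
    (η Δv : TorusSite 2 L → ℂ) (hη : ∀ r, η (-r) = η r) (hΔ : ∀ r, Δv (-r) = Δv r) (μ : ℝ) {a : ℝ}
    (ha : a ≠ 0)
    (hreal : ∀ k, star (torusFourier (fun r => η r - if r = 0 then (μ : ℂ) else 0) k) =
      torusFourier (fun r => η r - if r = 0 then (μ : ℂ) else 0) k) :
    ∃ κ : TorusSite 2 L → ℝ, (∀ k, 0 ≤ κ k) ∧ (∀ k, torusFourier Δv k ≠ 0 → 0 < κ k) ∧
      ∀ (n : ℕ) (θ : Fin (2 * n + 2) → ℝ),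
        ‖((List.ofFn fun t => Matrix.gibbsWeight a
            (bdgBondHamiltonian (fun u v => η (e u - e v))
              (fun u v => Complex.exp (Complex.I * θ t) * (-(1 / 2 : ℂ) * star (Δv (e u - e v)))) μ)).prod).trace‖ ≤
          ‖Complex.exp (-(a : ℂ) * ∑ _t : Fin (2 * n + 2), ∑ _x : Λ, (η 0 - μ))‖ *
            ∏ k : TorusSite 2 L, (2 + 2 * Real.cosh ((2 * n + 2) * a *
                Real.sqrt ((torusFourier (fun r => η r - if r = 0 then (μ : ℂ) else 0) k).re ^ 2 +
                  ‖torusFourier Δv k‖ ^ 2)) *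
              Real.exp (-(κ k / 2 * ∑ t : Fin (2 * n + 2), (1 - Real.cos (θ (t + 1) - θ t))))) := by
  obtain ⟨κ, hκ0, hκpos, hb⟩ :=
    exists_coercive_norm_trace_prod_gibbsWeight_bdgTorus_phase_le e η Δv hη hΔ μ ha hreal
  refine ⟨κ, hκ0, hκpos, fun n θ => (hb n θ).trans_eq ?_⟩
  congr 1
  refine Finset.prod_congr rfl fun k _ => ?_
  have hξ : (((torusFourier (fun r => η r - if r = 0 then (μ : ℂ) else 0) k).re : ℝ) : ℂ) =
      torusFourier (fun r => η r - if r = 0 then (μ : ℂ) else 0) k := Complex.conj_eq_iff_re.mp (hreal k)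
  have htr := trace_gaugeFix_gibbsWeight_symbolBlock_pow
    (torusFourier (fun r => η r - if r = 0 then (μ : ℂ) else 0) k).re (torusFourier Δv k) a (2 * n + 2)
  rw [hξ] at htr
  rw [← pow_two, ← pow_mul, show 2 * (n + 1) = 2 * n + 2 by ring, htr]
  push_cast
  ring1

end Ratio

end BirBdG

end Summit.HubbardSuperconductivity.HubbardSuperconductivity.Theorems
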